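import Mathlib
import HarnessLib

/-!
# The Ben-Or–Tiwari sparse interpolation algorithm: the auxiliary polynomial, its Toeplitz/Hankel
# system and the transposed Vandermonde system (Kaltofen–Yagati, ISSAC '88, §2 and Lemma 1)

Source: E. Kaltofen, Lakshman Yagati, *Improved sparse multivariate polynomial interpolation
algorithms*, Proc. ISSAC '88, Lecture Notes in Computer Science 358, Springer 1989, pp. 467–474
[cite: KaltofenYagati1989, §2] "The Ben-Or and Tiwari Interpolation Algorithm" (after M. Ben-Or and
P. Tiwari, STOC 1988).  Statements are quoted from the held text
`paper:doi-10-1007-3-540-51084-2-44` (pp. 2–3); locators are the paper's own section / lemma /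
equation numbers.

Verbatim (p. 2, "Notation" and §2).  "Let `P(x_1, …, x_n) = c_1 m_1 + c_2 m_2 + … + c_t m_t` be the
polynomial to be interpolated. The `m_i = x_1^{e_{i,1}} ⋯ x_n^{e_{i,n}}` are distinct monomials and
the `c_i` are the corresponding non-zero coefficients; `t` is the number of terms in `P`. Let
`v_i = p_1^{e_{i,1}} ⋯ p_n^{e_{i,n}}` denote the value of the monomial `m_i` at `(p_1, …, p_n)`
where `p_i` is the `i`-th prime number. Clearly, different monomials evaluate to different values
under this evaluation. Let `a_0, a_1, …, a_{2τ+1}` denote the value of `P` at the `2(τ+1)` points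
`(p_1^0, …, p_n^0), …, (p_1^{2(τ+1)-1}, …, p_n^{2(τ+1)-1})`. We have `a_i = ∑_{j=1}^{t} c_j v_j^i`.
… The algorithm needs as input an upper bound `τ + 1 ≥ t` on the number of terms in `P`. …
The polynomial `ζ(z)` is defined as follows. Let
`ζ(z) = ∏_{i=1}^{t} (z - v_i) = z^t + ζ_{t-1} z^{t-1} + … + ζ_1 z + ζ_0`.
Consider the sum `∑_{i=1}^{t} c_i v_i^j ζ(v_i) =`
`∑_{k=0}^{t-1} ζ_k (c_1 v_1^{k+j} + … + c_t v_t^{k+j}) + (c_1 v_1^{t+j} + … + c_t v_t^{t+j})`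
for all `j`, `0 ≤ j ≤ t-1`. Since
`ζ(v_i) = 0`, we have
`a_j ζ_0 + a_{j+1} ζ_1 + … + a_{j+t-1} ζ_{t-1} + a_{j+t} = 0,  0 ≤ j ≤ t-1.`
We now have the Toeplitz system `T_{t-1,t-1} ζ̂_{t-1} = t̂_{2t-1,t-1}` where `T_{u,v}` is the
`(v+1) × (v+1)` matrix with rows `(a_u, a_{u+1}, …, a_{u+v})`, `(a_{u-1}, a_u, …, a_{u+v-1})`, …,
`(a_{u-v}, a_{u-v+1}, …, a_u)`, `ζ̂_v = (ζ_0, …, ζ_v)ᵀ` and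
`t̂_{u,v} = -(a_u, a_{u-1}, …, a_{u-v})ᵀ`."

Verbatim (p. 3).  "This system is non-singular as can be seen from the factorization
`T_{t-1,t-1} = (v_l^{t-1-r})_{r,l} · diag(c_1, …, c_t) · (v_l^{s})_{l,s}`.  Since the `v_i` are
distinct, the two Vandermonde matrices are nonsingular and as no `c_i` is zero, the diagonal matrix
is nonsingular, too. If the input value of the upper bound `τ + 1` is greater than `t`, then the
coefficients `c_k`, for `k > t`, can be regarded as zero and the resulting system `T_{τ,τ}` would be
singular.
**Lemma 1.** If `t` is the exact number of terms in `P(x_1, …, x_n)`, then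
a) `T_{i,t-1}` is non-singular for all `i ≥ t - 1`.
b) `T_{i,t+j}` is singular for all `i ≥ t - 1`, `j ≥ 0`.
Proof. Every `T_{u,v}`, `u, v ≥ t - 1`, can be factored like `T_{t-1,t-1}` above. …
The roots of the polynomial `ζ(z)` give the `v_i` and by choosing the first `t` evaluations of `P`,
we get the following transposed Vandermonde system of equations `A ĉ = â` for the coefficients of
`P`, where `A = (v_i^{j})_{0 ≤ j < t, 1 ≤ i ≤ t}`, `ĉ = (c_1, …, c_t)ᵀ`, `â = (a_0, …, a_{t-1})ᵀ`.
(1)"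

Rendering.  The terms are indexed by `Fin t`; `c v : Fin t → K` are the coefficients and term values
in a commutative ring `K` (an integral domain / a field where the source needs "nonsingular");
`a = termValueSum c v : ℕ → K`, `a j = ∑_i c_i v_i^j`.  `ζ = btAuxPoly v = ∏_i (X - C v_i)`, with
`ζ_k = ζ.coeff k`.  The matrix `T_{u,v}` of the source is `btToeplitz a u v` (entry
`(r, s) ↦ a_{u-r+s}`, natural-number subtraction, so it is the source's matrix when `u ≥ v`); the
Hankel form `momentHankel a m w` (entry `(r, s) ↦ a_{m+r+s}`) is `T` with its rows reversed, and
`vandermondeRect v w` (entry `(l, s) ↦ v_l^s`, `w` columns) is the rectangular Vandermonde matrix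
(`= Matrix.vandermonde v` for `w = t`).  In Lemma 1 the source tacitly uses `v_i ≠ 0` (its `v_i` are
products of primes) for `i > t - 1`; we carry it as a hypothesis.  Lemma 1(b) is proved, as the
sentence preceding it suggests, by exhibiting the kernel vector `(ζ_0, …, ζ_t, 0, …, 0)`; it is
stated for `u ≥ v` (all indices of `T_{u,v}` genuine).

What is formalised (namespace `Literature.Algebra.Polynomial.BenOrTiwari`).
* `termValueSum`, `btAuxPoly` (+ `_monic`, `_natDegree`, `_eval`, `_coeff_card`);
  `sum_coeff_mul_termValueSum` (any polynomial vanishing at the `v_i` annihilates `(a_j)`),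
  `termValueSum_rec` — **the displayed recurrence** `a_j ζ_0 + ⋯ + a_{j+t-1} ζ_{t-1} + a_{j+t} = 0`
  (for every `j ≥ 0`), and `termValueSum_isSolution` (the same as a Mathlib `LinearRecurrence`).
* `momentHankel_termValueSum` / `btToeplitz_eq_submatrix` — **the factorization**
  `Vᵀ · diag(c_l v_l^m) · V`; `det_momentHankel_termValueSum`;
  `det_momentHankel_ne_zero` and `lemma_1a` (**Lemma 1(a)**); `momentHankel_mulVec_coeff`,
  `det_momentHankel_eq_zero` and `lemma_1b` (**Lemma 1(b)**, `T_{τ,τ}` singular for `τ + 1 > t`).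
* `auxPoly_coeff_unique` — the Toeplitz/Hankel system determines `ζ̂` uniquely (Step 2).
* `transposedVandermonde_mulVec` and `termCoeff_unique` — **(1)** `A ĉ = â` and its unique
  solvability (Step 4).
* `primePowerValue_injective` — "different monomials evaluate to different values".
-/

open Finset Matrix Polynomial Function

namespace Literature.Algebra.Polynomial.BenOrTiwari

variable {K : Type*} [CommRing K] {t : ℕ}

/-! ### The values `a_j` and the auxiliary polynomial `ζ` -/

/-- "`a_i = ∑_{j=1}^{t} c_j v_j^i`": the value of `P` at the `i`-th power point, as a function of
the coefficients `c` and term values `v`. [cite: KaltofenYagati1989, §2 (Notation)] -/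
def termValueSum (c v : Fin t → K) (j : ℕ) : K := ∑ i, c i * v i ^ j

/-- "`ζ(z) = ∏_{i=1}^{t} (z - v_i) = z^t + ζ_{t-1} z^{t-1} + … + ζ_0`", the auxiliary polynomial.
[cite: KaltofenYagati1989, §2] -/
noncomputable def btAuxPoly (v : Fin t → K) : K[X] := ∏ i, (X - C (v i))

/-- `ζ` is monic. [cite: KaltofenYagati1989, §2] -/
theorem btAuxPoly_monic (v : Fin t → K) : (btAuxPoly v).Monic :=
  monic_prod_of_monic _ _ fun i _ => monic_X_sub_C (v i)

/-- `deg ζ ≤ t` (equality in any nontrivial ring). [cite: KaltofenYagati1989, §2] -/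
theorem btAuxPoly_natDegree_le (v : Fin t → K) : (btAuxPoly v).natDegree ≤ t := by
  unfold btAuxPoly
  refine (natDegree_prod_le _ _).trans ?_
  refine (Finset.sum_le_sum fun i _ => natDegree_X_sub_C_le (v i)).trans ?_
  simp

/-- `deg ζ = t`. [cite: KaltofenYagati1989, §2] -/
theorem btAuxPoly_natDegree [Nontrivial K] (v : Fin t → K) : (btAuxPoly v).natDegree = t := by
  unfold btAuxPoly
  rw [natDegree_prod_of_monic _ _ fun i _ => monic_X_sub_C (v i)]
  simp

/-- "`ζ(v_i) = 0`". [cite: KaltofenYagati1989, §2] -/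
theorem btAuxPoly_eval (v : Fin t → K) (i : Fin t) : (btAuxPoly v).eval (v i) = 0 := by
  unfold btAuxPoly
  rw [eval_prod]
  exact Finset.prod_eq_zero (Finset.mem_univ i) (by simp)

/-- The leading coefficient: `ζ_t = 1`. [cite: KaltofenYagati1989, §2] -/
theorem btAuxPoly_coeff_card (v : Fin t → K) : (btAuxPoly v).coeff t = 1 := by
  cases subsingleton_or_nontrivial K with
  | inl h => exact Subsingleton.elim _ _
  | inr h =>
    have hm := btAuxPoly_monic v
    rw [Monic, leadingCoeff, btAuxPoly_natDegree] at hm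
    exact hm

/-- The mechanism behind the recurrence: "Consider the sum `∑_i c_i v_i^j ζ(v_i)` … Since
`ζ(v_i) = 0`": for ANY polynomial `Q` vanishing at all the `v_i` and any `n > deg Q`,
`∑_{k<n} Q_k a_{j+k} = ∑_i c_i v_i^j Q(v_i) = 0`. [cite: KaltofenYagati1989, §2] -/
theorem sum_coeff_mul_termValueSum (c v : Fin t → K) (Q : K[X]) (hQ : ∀ i, Q.eval (v i) = 0)
    {n : ℕ} (hn : Q.natDegree < n) (j : ℕ) :
    ∑ k ∈ range n, Q.coeff k * termValueSum c v (j + k) = 0 := by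
  have e : ∀ i, ∑ k ∈ range n, Q.coeff k * v i ^ k = Q.eval (v i) :=
    fun i => (eval_eq_sum_range' hn (v i)).symm
  calc ∑ k ∈ range n, Q.coeff k * termValueSum c v (j + k)
      = ∑ i, c i * v i ^ j * ∑ k ∈ range n, Q.coeff k * v i ^ k := by
        unfold termValueSum
        simp_rw [Finset.mul_sum]
        rw [Finset.sum_comm]
        refine Finset.sum_congr rfl fun i _ => Finset.sum_congr rfl fun k _ => ?_
        rw [pow_add]
        ring
    _ = 0 := by simp [e, hQ]

/-- **The recurrence** (display of §2):
"`a_j ζ_0 + a_{j+1} ζ_1 + … + a_{j+t-1} ζ_{t-1} + a_{j+t} = 0`"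
— stated in the source for `0 ≤ j ≤ t - 1`, valid for every `j ≥ 0`.
[cite: KaltofenYagati1989, §2] -/
theorem termValueSum_rec (c v : Fin t → K) (j : ℕ) :
    ∑ k ∈ range t, termValueSum c v (j + k) * (btAuxPoly v).coeff k +
      termValueSum c v (j + t) = 0 := by
  have h := sum_coeff_mul_termValueSum c v (btAuxPoly v) (btAuxPoly_eval v)
    (Nat.lt_succ_of_le (btAuxPoly_natDegree_le v)) j
  rw [Finset.sum_range_succ, btAuxPoly_coeff_card, one_mul] at h
  simpa [mul_comm] using h

/-- The same recurrence as a Mathlib `LinearRecurrence` of order `t` with coefficients `-ζ_k`: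
`a_{n+t} = ∑_k (-ζ_k) a_{n+k}`. [cite: KaltofenYagati1989, §2] -/
theorem termValueSum_isSolution (c v : Fin t → K) :
    (⟨t, fun k => -(btAuxPoly v).coeff k⟩ : LinearRecurrence K).IsSolution (termValueSum c v) := by
  intro n
  dsimp only
  have h := termValueSum_rec c v n
  rw [← Fin.sum_univ_eq_sum_range (fun k => termValueSum c v (n + k) * (btAuxPoly v).coeff k) t]
    at h
  calc termValueSum c v (n + t)
      = -∑ i : Fin t, termValueSum c v (n + i) * (btAuxPoly v).coeff i := by linear_combination h
    _ = ∑ i : Fin t, -(btAuxPoly v).coeff i * termValueSum c v (n + i) := by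
        rw [← Finset.sum_neg_distrib]
        exact Finset.sum_congr rfl fun i _ => by ring

/-! ### The Toeplitz / Hankel matrices and their Vandermonde factorization -/

/-- The Hankel matrix of a sequence: `(momentHankel a m w) r s = a_{m+r+s}` (`w × w`, shift `m`).
With its rows reversed it is the source's Toeplitz matrix `T_{m+w-1, w-1}`.
[cite: KaltofenYagati1989, §2 (T_{u,v})] -/
def momentHankel (a : ℕ → K) (m w : ℕ) : Matrix (Fin w) (Fin w) K :=
  Matrix.of fun r s => a (m + r + s)

/-- The source's "`T_{u,v}`": the `(v+1) × (v+1)` matrix with rows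
`(a_u, …, a_{u+v}), (a_{u-1}, …, a_{u+v-1}), …, (a_{u-v}, …, a_u)`, i.e. entry `(r, s) ↦ a_{u-r+s}`
(natural-number subtraction; this is the source's matrix for `u ≥ v`).
[cite: KaltofenYagati1989, §2 (T_{u,v})] -/
def btToeplitz (a : ℕ → K) (u v : ℕ) : Matrix (Fin (v + 1)) (Fin (v + 1)) K :=
  Matrix.of fun r s => a (u - r + s)

/-- The rectangular Vandermonde matrix `(v_l^s)_{l, s<w}`; for `w = t` it is `Matrix.vandermonde v`.
[cite: KaltofenYagati1989, §2 (factorization of T_{t-1,t-1})] -/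
def vandermondeRect (v : Fin t → K) (w : ℕ) : Matrix (Fin t) (Fin w) K :=
  Matrix.of fun l s => v l ^ (s : ℕ)

/-- `vandermondeRect v t = Matrix.vandermonde v`.
[cite: KaltofenYagati1989, §2 (factorization of T_{t-1,t-1})] -/
theorem vandermondeRect_self (v : Fin t → K) : vandermondeRect v t = Matrix.vandermonde v := by
  ext l s
  simp [vandermondeRect, Matrix.vandermonde_apply]

omit [CommRing K] in
/-- `T_{u,v}` is the Hankel matrix with shift `u - v` and its rows reversed (for `u ≥ v`).
[cite: KaltofenYagati1989, §2 (T_{u,v})] -/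
theorem btToeplitz_eq_submatrix (a : ℕ → K) {u v : ℕ} (huv : v ≤ u) :
    btToeplitz a u v =
      (momentHankel a (u - v) (v + 1)).submatrix (Fin.revPerm : Equiv.Perm _) id := by
  ext r s
  have hr := r.isLt
  simp only [btToeplitz, momentHankel, Matrix.submatrix_apply, Matrix.of_apply, id,
    Fin.revPerm_apply, Fin.val_rev]
  congr 1
  omega

/-- **The factorization** (p. 3): "`T_{t-1,t-1} = (v_l^{t-1-r}) · diag(c) · (v_l^s)`", in Hankel
form
and for every shift `m` and size `w`:
`(a_{m+r+s})_{r,s<w} = Vᵀ · diag(c_l v_l^m) · V` with `V = (v_l^s)_{l, s<w}`.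
[cite: KaltofenYagati1989, §2 (factorization of T_{t-1,t-1}) and Lemma 1 (proof)] -/
theorem momentHankel_termValueSum (c v : Fin t → K) (m w : ℕ) :
    momentHankel (termValueSum c v) m w =
      (vandermondeRect v w)ᵀ * Matrix.diagonal (fun l => c l * v l ^ m) * vandermondeRect v w := by
  ext r s
  rw [Matrix.mul_apply]
  simp only [momentHankel, termValueSum, Matrix.of_apply, Matrix.mul_diagonal,
    Matrix.transpose_apply, vandermondeRect, pow_add]
  exact Finset.sum_congr rfl fun l _ => by ring

/-- Determinant of the factorization: `det (a_{m+r+s})_{r,s<t} = (∏_l c_l v_l^m) · (det V)²` with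
`V` the square Vandermonde matrix of `v`.
[cite: KaltofenYagati1989, §2 (factorization of T_{t-1,t-1})] -/
theorem det_momentHankel_termValueSum (c v : Fin t → K) (m : ℕ) :
    (momentHankel (termValueSum c v) m t).det =
      (∏ l, c l * v l ^ m) * (Matrix.vandermonde v).det ^ 2 := by
  rw [momentHankel_termValueSum, vandermondeRect_self, Matrix.det_mul, Matrix.det_mul,
    Matrix.det_transpose, Matrix.det_diagonal]
  ring

/-- "Since the `v_i` are distinct, the two Vandermonde matrices are nonsingular and as no `c_i` is
zero, the diagonal matrix is nonsingular, too": the `t × t` Hankel matrix with shift `m` is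
nonsingular when the `v_l` are pairwise distinct and no `c_l v_l^m` vanishes.
[cite: KaltofenYagati1989, §2 (T_{t-1,t-1} non-singular)] -/
theorem det_momentHankel_ne_zero [IsDomain K] {c v : Fin t → K} {m : ℕ} (hv : Injective v)
    (hcm : ∀ l, c l * v l ^ m ≠ 0) : (momentHankel (termValueSum c v) m t).det ≠ 0 := by
  rw [det_momentHankel_termValueSum]
  refine mul_ne_zero (Finset.prod_ne_zero_iff.mpr fun l _ => hcm l) (pow_ne_zero _ ?_)
  exact Matrix.det_vandermonde_ne_zero_iff.mpr hv

/-- The case `m = 0`, i.e. `T_{t-1,t-1}`: "This system is non-singular".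
[cite: KaltofenYagati1989, §2 (T_{t-1,t-1} non-singular)] -/
theorem det_momentHankel_zero_ne_zero [IsDomain K] {c v : Fin t → K} (hv : Injective v)
    (hc : ∀ l, c l ≠ 0) : (momentHankel (termValueSum c v) 0 t).det ≠ 0 :=
  det_momentHankel_ne_zero hv fun l => by simpa using hc l

/-- **Lemma 1 (a)**: "`T_{i,t-1}` is non-singular for all `i ≥ t - 1`" (with `t ≥ 1` terms,
pairwise distinct nonzero term values `v_l` and nonzero coefficients `c_l`).
[cite: KaltofenYagati1989, Lemma 1 (a)] -/
theorem lemma_1a [IsDomain K] {s : ℕ} {c v : Fin (s + 1) → K} (hv : Injective v)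
    (hv0 : ∀ l, v l ≠ 0) (hc : ∀ l, c l ≠ 0) {i : ℕ} (hi : s ≤ i) :
    (btToeplitz (termValueSum c v) i s).det ≠ 0 := by
  rw [btToeplitz_eq_submatrix _ hi, Matrix.det_permute]
  refine mul_ne_zero ?_ (det_momentHankel_ne_zero hv fun l => mul_ne_zero (hc l)
    (pow_ne_zero _ (hv0 l)))
  rcases Int.units_eq_one_or (Equiv.Perm.sign (Fin.revPerm : Equiv.Perm (Fin (s + 1))))
    with h | h <;> simp [h]

/-- The kernel vector behind Lemma 1 (b): for `w > t` (more unknowns than terms) the Hankel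
matrix annihilates `(ζ_0, …, ζ_t, 0, …, 0)` — "the coefficients `c_k`, for `k > t`, can be regarded
as zero". [cite: KaltofenYagati1989, Lemma 1 (b)] -/
theorem momentHankel_mulVec_coeff (c v : Fin t → K) (m : ℕ) {w : ℕ} (hw : t < w) :
    momentHankel (termValueSum c v) m w *ᵥ (fun s => (btAuxPoly v).coeff s) = 0 := by
  funext r
  simp only [Matrix.mulVec, dotProduct, momentHankel, Matrix.of_apply, Pi.zero_apply]
  rw [Fin.sum_univ_eq_sum_range (fun s => termValueSum c v (m + r + s) * (btAuxPoly v).coeff s) w]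
  have h := sum_coeff_mul_termValueSum c v (btAuxPoly v) (btAuxPoly_eval v)
    (lt_of_le_of_lt (btAuxPoly_natDegree_le v) hw) (m + r)
  simpa [mul_comm] using h

/-- "If the input value of the upper bound `τ + 1` is greater than `t` … the resulting system
`T_{τ,τ}` would be singular": every `w × w` Hankel matrix of `(a_j)` with `w > t` is singular.
[cite: KaltofenYagati1989, Lemma 1 (b)] -/
theorem det_momentHankel_eq_zero [IsDomain K] (c v : Fin t → K) (m : ℕ) {w : ℕ} (hw : t < w) :
    (momentHankel (termValueSum c v) m w).det = 0 := by
  classical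
  refine Matrix.exists_mulVec_eq_zero_iff.mp ⟨fun s => (btAuxPoly v).coeff s, ?_,
    momentHankel_mulVec_coeff c v m hw⟩
  intro h
  have h1 : (btAuxPoly v).coeff t = 0 := by simpa using congrFun h ⟨t, hw⟩
  rw [btAuxPoly_coeff_card] at h1
  exact one_ne_zero h1

/-- **Lemma 1 (b)**: "`T_{i,t+j}` is singular for all … `j ≥ 0`" — here for `i ≥ t + j`, so that all
indices of `T_{i,t+j}` are genuine; in particular `T_{τ,τ}` is singular whenever `τ + 1 > t`.
[cite: KaltofenYagati1989, Lemma 1 (b)] -/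
theorem lemma_1b [IsDomain K] (c v : Fin t → K) {i j : ℕ} (hi : t + j ≤ i) :
    (btToeplitz (termValueSum c v) i (t + j)).det = 0 := by
  rw [btToeplitz_eq_submatrix _ hi, Matrix.det_permute,
    det_momentHankel_eq_zero c v (i - (t + j)) (show t < t + j + 1 by omega), mul_zero]

/-- `T_{τ,τ}` is singular for `τ + 1 > t`. [cite: KaltofenYagati1989, Lemma 1 (b)] -/
theorem det_btToeplitz_eq_zero [IsDomain K] (c v : Fin t → K) {τ : ℕ} (hτ : t < τ + 1) :
    (btToeplitz (termValueSum c v) τ τ).det = 0 := by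
  obtain ⟨j, rfl⟩ : ∃ j, τ = t + j := ⟨τ - t, by omega⟩
  exact lemma_1b c v le_rfl

/-! ### Step 2 and Step 4: unique solvability -/

/-- Step 2 ("Solve the Toeplitz system … to obtain the polynomial `ζ(z)`"): the `2t` values
`a_0, …, a_{2t-1}` determine `ζ̂ = (ζ_0, …, ζ_{t-1})` uniquely — any solution `μ` of
`a_j μ_0 + ⋯ + a_{j+t-1} μ_{t-1} + a_{j+t} = 0` (`0 ≤ j ≤ t-1`) equals `ζ̂`.
[cite: KaltofenYagati1989, §2 (Step 2)] -/
theorem auxPoly_coeff_unique [IsDomain K] {c v : Fin t → K} (hv : Injective v) (hc : ∀ l, c l ≠ 0)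
    (μ : Fin t → K)
    (hμ : ∀ j : Fin t, ∑ k : Fin t, termValueSum c v (j + k) * μ k + termValueSum c v (j + t) = 0) :
    μ = fun k : Fin t => (btAuxPoly v).coeff k := by
  classical
  have hsys : ∀ ν : Fin t → K,
      (∀ j : Fin t, ∑ k : Fin t, termValueSum c v (j + k) * ν k + termValueSum c v (j + t) = 0) →
        momentHankel (termValueSum c v) 0 t *ᵥ ν = fun j : Fin t => -termValueSum c v (j + t) := by
    intro ν hν
    funext j
    simp only [Matrix.mulVec, dotProduct, momentHankel, Matrix.of_apply, zero_add]
    linear_combination hν j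
  have hζ : ∀ j : Fin t, ∑ k : Fin t, termValueSum c v (j + k) * (btAuxPoly v).coeff k +
      termValueSum c v (j + t) = 0 := by
    intro j
    rw [Fin.sum_univ_eq_sum_range (fun k => termValueSum c v (j + k) * (btAuxPoly v).coeff k) t]
    exact termValueSum_rec c v j
  have hdiff :
      momentHankel (termValueSum c v) 0 t *ᵥ (μ - fun k : Fin t => (btAuxPoly v).coeff k) = 0 := by
    rw [Matrix.mulVec_sub, hsys μ hμ, hsys _ hζ, sub_self]
  exact sub_eq_zero.mp
    (Matrix.eq_zero_of_mulVec_eq_zero (det_momentHankel_zero_ne_zero hv hc) hdiff)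

/-- **(1)**, Step 4: "the transposed Vandermonde system of equations `A ĉ = â` for the coefficients
of `P`", `A = (v_i^j)_{j,i}`, `â = (a_0, …, a_{t-1})ᵀ`: the coefficient vector solves it.
[cite: KaltofenYagati1989, §2 (1)] -/
theorem transposedVandermonde_mulVec (c v : Fin t → K) :
    (Matrix.vandermonde v)ᵀ *ᵥ c = fun j : Fin t => termValueSum c v j := by
  funext j
  simp only [Matrix.mulVec, dotProduct, Matrix.transpose_apply, Matrix.vandermonde_apply,
    termValueSum]
  exact Finset.sum_congr rfl fun i _ => mul_comm _ _

/-- Step 4, unique solvability of (1): for pairwise distinct `v_i` the coefficients are the unique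
solution of `A ĉ = â`. [cite: KaltofenYagati1989, §2 (1)] -/
theorem termCoeff_unique [IsDomain K] {c v : Fin t → K} (hv : Injective v) (c' : Fin t → K)
    (h : (Matrix.vandermonde v)ᵀ *ᵥ c' = fun j : Fin t => termValueSum c v j) : c' = c := by
  classical
  have hdet : ((Matrix.vandermonde v)ᵀ).det ≠ 0 := by
    rw [Matrix.det_transpose]
    exact Matrix.det_vandermonde_ne_zero_iff.mpr hv
  have hdiff : (Matrix.vandermonde v)ᵀ *ᵥ (c' - c) = 0 := by
    rw [Matrix.mulVec_sub, h, transposedVandermonde_mulVec, sub_self]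
  exact sub_eq_zero.mp (Matrix.eq_zero_of_mulVec_eq_zero hdet hdiff)

/-! ### Distinct monomials have distinct values at the primes -/

/-- "`v_i = p_1^{e_{i,1}} ⋯ p_n^{e_{i,n}}` … Clearly, different monomials evaluate to different
values under this evaluation": for pairwise distinct primes `p_1, …, p_n`, the exponent vector `e`
is recovered from `∏_l p_l^{e_l}` (unique factorization), so the evaluation is injective.
[cite: KaltofenYagati1989, §2 (Notation)] -/
theorem factorization_primePowerValue {n : ℕ} {p : Fin n → ℕ} (hp : ∀ l, (p l).Prime)
    (hinj : Injective p) (e : Fin n → ℕ) (l : Fin n) :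
    (∏ i, p i ^ e i).factorization (p l) = e l := by
  rw [Nat.factorization_prod fun i _ => pow_ne_zero _ (hp i).ne_zero, Finset.sum_apply']
  simp_rw [(hp _).factorization_pow, Finsupp.single_apply]
  rw [Finset.sum_eq_single l]
  · simp
  · intro i _ hil
    exact if_neg fun h => hil (hinj h)
  · intro h
    exact absurd (Finset.mem_univ l) h

/-- "different monomials evaluate to different values": `e ↦ ∏_l p_l^{e_l}` is injective for
pairwise distinct primes `p_l`. [cite: KaltofenYagati1989, §2 (Notation)] -/
theorem primePowerValue_injective {n : ℕ} {p : Fin n → ℕ} (hp : ∀ l, (p l).Prime)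
    (hinj : Injective p) : Injective (fun e : Fin n → ℕ => ∏ i, p i ^ e i) := by
  intro e e' h
  funext l
  rw [← factorization_primePowerValue hp hinj e l, ← factorization_primePowerValue hp hinj e' l]
  exact congrArg (fun m : ℕ => m.factorization (p l)) h

end Literature.Algebra.Polynomial.BenOrTiwari
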